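/-
Copyright (c) 2026. All rights reserved.
Released under Apache 2.0 license as described in the file LICENSE.
-/
import Summits.RiemannHypothesis.RiemannHypothesis.Theorems.PfPersistenceWeilParityPairEigen
import HarnessLib

/-!
# PF persistence — PARITY DOUBLET LAWS for the Weil window blocks (leaf G1.05eo-ORDER)

mechanism/rigidity campaign; no RH claims.  RH-free, `sorry`-free, valid for EVERY weight table `w` and
every window `win`; nothing here is specific to `ζ`.

The dictionary `oddBlock w win = oddOfEven (evenBlock w win)` (file `PfPersistenceWeilParityPair`) makes the
odd block the diagonal conjugate of the BORDER-DEFLATED EVEN BODY `deflatedBody E = P − √2·𝟙 bᵀ`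
(`E = [[q₀₀, bᵀ], [b, P]]` the even block).  This file turns that into two-sided RAYLEIGH BOUNDS between the
parity ground levels ("parity doublet laws") and two SIGN RULES for the order bit:

* `deflatedBody_mulVec_tail` : an even eigenpair `E v = ε v` gives `deflatedBody E (tail v) = ε·tail v − v₀·r`
  with the BORDER RESIDUAL `r_i = E (i+1) 0 + √2 (ε − E 0 0)` (`borderResidual`);
* `oddBlock_mulVec_scaleDown_tail` : hence `M u = ε u − v₀·Ω⁻¹ r` for `u = Ω⁻¹ (tail v)` (`scaleDown`);
* `bottomRayleigh_oddBlock_mul_le` (DOUBLET UPPER LAW) :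
  `ε₁(odd)·‖u‖² ≤ ε·‖u‖² − v₀·⟨u, Ω⁻¹ r⟩` — the odd bottom exceeds an even level by at most MEAN × COUPLING;
  in particular (`bottomRayleigh_oddBlock_le'`) `v₀ = 0 ⇒ ε₁(odd) ≤ ε` (recovering `bottomRayleigh_oddBlock_le`);
* `mean_mul_coupling_neg_of_even_bottom_lt` (SIGN RULE 1) : EVEN STRICTLY BOTTOM ⇒ `v₀·⟨u, Ω⁻¹ r⟩ < 0` for
  every even bottom vector with nonzero tail;
* `evenForm_cons_zero`, `bottomRayleigh_evenBlock_mul_le` (DOUBLET LOWER LAW) : an odd eigenpair `M u = μ u`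
  gives, with `x = Ω u` (`scaleUp`), `ε₁(even)·‖x‖² ≤ μ·‖x‖² + √2·(bᵀx)·(𝟙ᵀx)`;
* `border_coupling_pos_of_odd_bottom_lt` (SIGN RULE 2) : ODD STRICTLY BOTTOM ⇒ `(bᵀx)·(𝟙ᵀx) > 0` for every
  odd bottom vector — the odd ground state must couple to the even border row `b` and to the flat mode `𝟙`
  with the SAME sign.

So the order bit `[ε₁(even) < ε₁(odd)]` is controlled, in both directions, by couplings of ground states to the
BORDER ROW of the even block; the DATA 'parity doublet' of `ζ` (odd bottom − even bottom → 0 with the mean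
coordinate `v₀ → 0`, census C6-EO-2r) is the shadow of the upper law.  [folklore: Rayleigh–Ritz with explicit
test vectors; the bordered/deflated structure is this campaign's dictionary.]
-/

set_option linter.dupNamespace false

noncomputable section

open Real Finset Matrix

namespace Summit.RiemannHypothesis.RiemannHypothesis.Theorems.PfPersistence

variable {N : ℕ}

/-! ## §1 The border residual and the deflated action on an even eigen-tail -/

/-- BORDER RESIDUAL of an even level `ε`: `r_i(E, ε) := E (i+1) 0 + √2·(ε − E 0 0)`. [folklore] -/
def borderResidual (E : Matrix (Fin (N + 1)) (Fin (N + 1)) ℝ) (ε : ℝ) : Fin N → ℝ :=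
  fun i => E i.succ 0 + Real.sqrt 2 * (ε - E 0 0)

/-- PROVED: entrywise form of the deflated body's action. [folklore] -/
theorem deflatedBody_mulVec_apply (E : Matrix (Fin (N + 1)) (Fin (N + 1)) ℝ) (x : Fin N → ℝ) (i : Fin N) :
    (deflatedBody E *ᵥ x) i = (∑ j, E i.succ j.succ * x j) - Real.sqrt 2 * ∑ j, E 0 j.succ * x j := by
  simp only [Matrix.mulVec, dotProduct, deflatedBody]
  rw [Finset.mul_sum, ← Finset.sum_sub_distrib]
  exact Finset.sum_congr rfl fun j _ => by ring

/-- PROVED: an even eigen-equation `E v = ε v` makes the deflated body act on the TAIL of `v` as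
`ε·tail v − v₀·r(E, ε)`. [folklore] -/
theorem deflatedBody_mulVec_tail (E : Matrix (Fin (N + 1)) (Fin (N + 1)) ℝ) {ε : ℝ}
    {v : Fin (N + 1) → ℝ} (hv : E *ᵥ v = ε • v) :
    deflatedBody E *ᵥ Fin.tail v = ε • Fin.tail v - v 0 • borderResidual E ε := by
  funext i
  have h0 := congrFun hv 0
  have hi := congrFun hv i.succ
  simp only [Matrix.mulVec, dotProduct, Fin.sum_univ_succ, Pi.smul_apply, smul_eq_mul] at h0 hi
  rw [deflatedBody_mulVec_apply]
  simp only [Fin.tail, Pi.sub_apply, Pi.smul_apply, smul_eq_mul, borderResidual]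
  linear_combination hi - Real.sqrt 2 * h0

/-- PROVED: for an even eigenpair `(ε, v)` of the even block, the ODD block acts on `u := Ω⁻¹ (tail v)` as
`M u = ε·u − v₀·Ω⁻¹ r`. [folklore] -/
theorem oddBlock_mulVec_scaleDown_tail (w : Weights) (win : Window) {ε : ℝ} {v : Fin (win.N + 1) → ℝ}
    (hv : evenBlock w win *ᵥ v = ε • v) :
    oddBlock w win *ᵥ scaleDown (Fin.tail v)
      = ε • scaleDown (Fin.tail v) - v 0 • scaleDown (borderResidual (evenBlock w win) ε) := by
  funext i
  have hi : ((((i : ℕ) + 1 : ℕ) : ℝ)) ≠ 0 := by positivity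
  rw [oddBlock_eq_oddOfEven, oddOfEven_mulVec, scaleUp_scaleDown, deflatedBody_mulVec_tail _ hv]
  simp only [Pi.sub_apply, Pi.smul_apply, smul_eq_mul, scaleDown]
  field_simp

/-- PROVED: the odd Rayleigh numerator at `u = Ω⁻¹ (tail v)`:
`⟨u, M u⟩ = ε·⟨u,u⟩ − v₀·⟨u, Ω⁻¹ r⟩`. [folklore] -/
theorem oddForm_scaleDown_tail (w : Weights) (win : Window) {ε : ℝ} {v : Fin (win.N + 1) → ℝ}
    (hv : evenBlock w win *ᵥ v = ε • v) :
    scaleDown (Fin.tail v) ⬝ᵥ (oddBlock w win *ᵥ scaleDown (Fin.tail v))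
      = ε * (scaleDown (Fin.tail v) ⬝ᵥ scaleDown (Fin.tail v))
        - v 0 * (scaleDown (Fin.tail v) ⬝ᵥ scaleDown (borderResidual (evenBlock w win) ε)) := by
  rw [oddBlock_mulVec_scaleDown_tail w win hv, dotProduct_sub, dotProduct_smul, dotProduct_smul, smul_eq_mul,
    smul_eq_mul]

/-! ## §2 Doublet UPPER law and sign rule 1 (even strictly bottom) -/

/-- PROVED (DOUBLET UPPER LAW, homogeneous form): for every even eigenpair `(ε, v)`,
`ε₁(odd)·‖u‖² ≤ ε·‖u‖² − v₀·⟨u, Ω⁻¹ r⟩` with `u = Ω⁻¹(tail v)` — the odd bottom exceeds the even level by at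
most MEAN × BORDER COUPLING. [folklore] -/
theorem bottomRayleigh_oddBlock_mul_le (w : Weights) (win : Window) {ε : ℝ} {v : Fin (win.N + 1) → ℝ}
    (hv : evenBlock w win *ᵥ v = ε • v) :
    bottomRayleigh (oddBlock w win) * (scaleDown (Fin.tail v) ⬝ᵥ scaleDown (Fin.tail v))
      ≤ ε * (scaleDown (Fin.tail v) ⬝ᵥ scaleDown (Fin.tail v))
        - v 0 * (scaleDown (Fin.tail v) ⬝ᵥ scaleDown (borderResidual (evenBlock w win) ε)) := by
  rw [← oddForm_scaleDown_tail w win hv]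
  exact bottomRayleigh_mul_le_form _ _

/-- PROVED: `Ω⁻¹ u ≠ 0` for `u ≠ 0`. [folklore] -/
theorem scaleDown_ne_zero {u : Fin N → ℝ} (hu : u ≠ 0) : scaleDown u ≠ 0 := by
  intro h
  apply hu
  have := congrArg scaleUp h
  rw [scaleUp_scaleDown] at this
  rw [this]
  funext j
  simp [scaleUp]

/-- PROVED: `0 < uᵀu` for `u ≠ 0` (any dimension; the tree's unprimed version is stated on `Fin (N+1)`). [folklore] -/
theorem dotProduct_self_pos_of_ne_zero' {u : Fin N → ℝ} (hu : u ≠ 0) : 0 < u ⬝ᵥ u :=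
  lt_of_le_of_ne (dotProduct_self_nonneg_real u) fun h => hu (dotProduct_self_eq_zero.1 h.symm)

/-- PROVED (DOUBLET UPPER LAW, quotient form): `ε₁(odd) − ε ≤ −v₀·⟨u, Ω⁻¹ r⟩/‖u‖²` whenever the tail of the
even eigenvector is nonzero. [folklore] -/
theorem bottomRayleigh_oddBlock_sub_le (w : Weights) (win : Window) {ε : ℝ} {v : Fin (win.N + 1) → ℝ}
    (hv : evenBlock w win *ᵥ v = ε • v) (htail : Fin.tail v ≠ 0) :
    bottomRayleigh (oddBlock w win) - ε
      ≤ -(v 0 * (scaleDown (Fin.tail v) ⬝ᵥ scaleDown (borderResidual (evenBlock w win) ε))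
          / (scaleDown (Fin.tail v) ⬝ᵥ scaleDown (Fin.tail v))) := by
  have hpos := dotProduct_self_pos_of_ne_zero' (scaleDown_ne_zero htail)
  have h := bottomRayleigh_oddBlock_mul_le w win hv
  rw [le_neg, neg_sub, div_le_iff₀ hpos]
  linarith

/-- PROVED: special case `v₀ = 0` — the even level lies above the odd bottom (this recovers
`bottomRayleigh_oddBlock_le` of the Eigen file with the mean-zero hypothesis in place of the product form).
[folklore] -/
theorem bottomRayleigh_oddBlock_le' (w : Weights) (win : Window) {ε : ℝ} {v : Fin (win.N + 1) → ℝ}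
    (hv : evenBlock w win *ᵥ v = ε • v) (htail : Fin.tail v ≠ 0) (h0 : v 0 = 0) :
    bottomRayleigh (oddBlock w win) ≤ ε := by
  have hpos := dotProduct_self_pos_of_ne_zero' (scaleDown_ne_zero htail)
  have h := bottomRayleigh_oddBlock_mul_le w win hv
  rw [h0, zero_mul, sub_zero] at h
  exact le_of_mul_le_mul_right h hpos

/-- PROVED (SIGN RULE 1): if the EVEN sector is STRICTLY bottom at the window, then for every even bottom vector
`v` with nonzero tail, MEAN × BORDER COUPLING is negative: `v₀·⟨Ω⁻¹ tail v, Ω⁻¹ r(E, ε₁)⟩ < 0` (in particular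
`v₀ ≠ 0` and the coupling `≠ 0`). [folklore] -/
theorem mean_mul_coupling_neg_of_even_bottom_lt (w : Weights) (win : Window) {v : Fin (win.N + 1) → ℝ}
    (hv : IsBottomVector (evenBlock w win) v) (htail : Fin.tail v ≠ 0)
    (hlt : bottomRayleigh (evenBlock w win) < bottomRayleigh (oddBlock w win)) :
    v 0 * (scaleDown (Fin.tail v)
      ⬝ᵥ scaleDown (borderResidual (evenBlock w win) (bottomRayleigh (evenBlock w win)))) < 0 := by
  have hpos := dotProduct_self_pos_of_ne_zero' (scaleDown_ne_zero htail)
  have h := bottomRayleigh_oddBlock_mul_le w win hv.2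
  have := mul_lt_mul_of_pos_right hlt hpos
  linarith

/-! ## §3 Doublet LOWER law and sign rule 2 (odd strictly bottom) -/

/-- PROVED: the even form on a mean-free test vector `(0, x)` is the body form, i.e. the deflated form plus the
border correction `√2·(bᵀx)·(𝟙ᵀx)`. [folklore] -/
theorem evenForm_cons_zero (E : Matrix (Fin (N + 1)) (Fin (N + 1)) ℝ) (x : Fin N → ℝ) :
    Fin.cons 0 x ⬝ᵥ (E *ᵥ Fin.cons 0 x)
      = x ⬝ᵥ (deflatedBody E *ᵥ x) + Real.sqrt 2 * (∑ j, E 0 j.succ * x j) * ∑ i, x i := by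
  have hbody : Fin.cons 0 x ⬝ᵥ (E *ᵥ Fin.cons 0 x) = ∑ i, x i * ∑ j, E i.succ j.succ * x j := by
    simp [dotProduct, Matrix.mulVec, Fin.sum_univ_succ, Fin.cons_zero, Fin.cons_succ]
  set B := ∑ j, E 0 j.succ * x j with hB
  have hdefl : x ⬝ᵥ (deflatedBody E *ᵥ x)
      = (∑ i, x i * ∑ j, E i.succ j.succ * x j) - Real.sqrt 2 * B * ∑ i, x i := by
    simp only [dotProduct, deflatedBody_mulVec_apply, ← hB]
    have hs : Real.sqrt 2 * B * ∑ i, x i = ∑ i, Real.sqrt 2 * B * x i := by rw [Finset.mul_sum]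
    rw [hs, ← Finset.sum_sub_distrib]
    exact Finset.sum_congr rfl fun i _ => by ring
  rw [hbody, hdefl]
  ring

/-- PROVED: `‖(0, x)‖² = ‖x‖²`. [folklore] -/
theorem cons_zero_dotProduct_self (x : Fin N → ℝ) : Fin.cons (0 : ℝ) x ⬝ᵥ Fin.cons 0 x = x ⬝ᵥ x := by
  simp [dotProduct, Fin.sum_univ_succ, Fin.cons_zero, Fin.cons_succ]

/-- PROVED (DOUBLET LOWER LAW, homogeneous form): for every odd eigenpair `(μ, u)` of the odd block, with
`x = Ω u`, `ε₁(even)·‖x‖² ≤ μ·‖x‖² + √2·(bᵀx)·(𝟙ᵀx)` — the even bottom lies below the odd level up to the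
BORDER × FLAT coupling of the odd state. [folklore] -/
theorem bottomRayleigh_evenBlock_mul_le (w : Weights) (win : Window) {μ : ℝ} {u : Fin win.N → ℝ}
    (h : oddBlock w win *ᵥ u = μ • u) :
    bottomRayleigh (evenBlock w win) * (scaleUp u ⬝ᵥ scaleUp u)
      ≤ μ * (scaleUp u ⬝ᵥ scaleUp u)
        + Real.sqrt 2 * (∑ j, evenBlock w win 0 j.succ * scaleUp u j) * ∑ i, scaleUp u i := by
  have hD : deflatedBody (evenBlock w win) *ᵥ scaleUp u = μ • scaleUp u := by
    rw [oddBlock_eq_oddOfEven] at h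
    exact (oddOfEven_mulVec_eq_smul_iff _ _ _).1 h
  have key := bottomRayleigh_mul_le_form (evenBlock w win) (Fin.cons 0 (scaleUp u))
  rw [cons_zero_dotProduct_self, evenForm_cons_zero, hD, dotProduct_smul, smul_eq_mul] at key
  exact key

/-- PROVED (SIGN RULE 2): if the ODD sector is STRICTLY bottom at the window, then every odd bottom vector `u`
couples to the even BORDER ROW `b` and to the FLAT mode `𝟙` with the same sign: `(bᵀ Ωu)·(𝟙ᵀ Ωu) > 0`.
[folklore] -/
theorem border_coupling_pos_of_odd_bottom_lt (w : Weights) (win : Window) {u : Fin win.N → ℝ}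
    (hu : IsBottomVector (oddBlock w win) u)
    (hlt : bottomRayleigh (oddBlock w win) < bottomRayleigh (evenBlock w win)) :
    0 < (∑ j, evenBlock w win 0 j.succ * scaleUp u j) * ∑ i, scaleUp u i := by
  have hpos := dotProduct_self_pos_of_ne_zero' (scaleUp_ne_zero hu.1)
  have h := bottomRayleigh_evenBlock_mul_le w win hu.2
  have := mul_lt_mul_of_pos_right hlt hpos
  have h2 : (0 : ℝ) < Real.sqrt 2 := by positivity
  nlinarith

/-- PROVED (TWO-SIDED DOUBLET SANDWICH at a window, homogeneous): for an even eigenpair `(ε, v)` and an odd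
eigenpair `(μ, u)`, the parity bottoms are pinned between the two levels up to the two border couplings. [folklore] -/
theorem parity_bottoms_sandwich (w : Weights) (win : Window) {ε μ : ℝ} {v : Fin (win.N + 1) → ℝ}
    {u : Fin win.N → ℝ} (hv : evenBlock w win *ᵥ v = ε • v) (hu : oddBlock w win *ᵥ u = μ • u) :
    bottomRayleigh (oddBlock w win) * (scaleDown (Fin.tail v) ⬝ᵥ scaleDown (Fin.tail v))
        ≤ ε * (scaleDown (Fin.tail v) ⬝ᵥ scaleDown (Fin.tail v))
          - v 0 * (scaleDown (Fin.tail v) ⬝ᵥ scaleDown (borderResidual (evenBlock w win) ε))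
      ∧ bottomRayleigh (evenBlock w win) * (scaleUp u ⬝ᵥ scaleUp u)
        ≤ μ * (scaleUp u ⬝ᵥ scaleUp u)
          + Real.sqrt 2 * (∑ j, evenBlock w win 0 j.succ * scaleUp u j) * ∑ i, scaleUp u i :=
  ⟨bottomRayleigh_oddBlock_mul_le w win hv, bottomRayleigh_evenBlock_mul_le w win hu⟩

end Summit.RiemannHypothesis.RiemannHypothesis.Theorems.PfPersistence

end
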